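import Summits.FinalStateConjecture.FinalStateConjecture.Theorems.ClusterCompletenessAdiabaticMultiKerrILEDField
import Summits.FinalStateConjecture.FinalStateConjecture.Theorems.ClusterCompletenessAdiabaticMultiKerrILEDFiniteTimeAux
import Summits.FinalStateConjecture.FinalStateConjecture.Theorems.ClusterCompletenessAdiabaticMultiKerrILEDSlabWeight
import Summits.FinalStateConjecture.FinalStateConjecture.Theorems.ClusterCompletenessAdiabaticMultiKerrILEDSlabGronwall
import Literature.Geometry.Lorentzian.KerrDomainOfDependence
import Literature.Geometry.Lorentzian.KerrSchildLocalEnergy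

/-!
# Route ClusterCompleteness — crux `AdiabaticMultiKerrILED`, line `Sketch`: late-time energy bound, `N = 0`

Helper file for the crux `stmt-FinalStateConjecture-14310`, closing the registered stub
`stub_lateEnergyBound_zero` of line `Sketch` (skeleton v6): for the empty configuration the patched
field is exactly `η` and the lab energy of every smooth solution on `{t ≥ 0}` satisfies
`E[ψ](t) ≤ 18 E[ψ](0)` — the slab Grönwall engine (`stub_slabGronwall`) with `D = 0`, the weight of
`stub_slabWeight` (no horizon factors for `Fin 0`), exhaustion as in `stub_finiteTimeEnergy`.
Hawking–Ellis 1973, §4.3, Lemma 4.3.1 (flat case). [folklore]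
-/

noncomputable section

-- the doubled `FinalStateConjecture.FinalStateConjecture` path component trips dupNamespace
set_option linter.dupNamespace false

open scoped ContDiff Topology InnerProductSpace BigOperators ENNReal
open MeasureTheory Metric Set Filter Literature.Geometry.Lorentzian

namespace Summit.FinalStateConjecture.FinalStateConjecture.Cruxes.AdiabaticMultiKerrILED.Sketch

/-- The vector `−e₀ + e₁ = (−1, 1, 0, 0)` is `η`-null and normalised against `e₀`:
`η(l, l) = 0`, `η(l, e₀) = 1` (signature `(−,+,+,+)`; O'Neill 1983, Ch. 3, p. 55). [folklore] -/
private theorem lez_bilin_negBasisZero_add_basisOne :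
    Minkowski.bilin (-E4.basisVector 0 + E4.basisVector 1) (-E4.basisVector 0 + E4.basisVector 1) = 0 ∧
      Minkowski.bilin (-E4.basisVector 0 + E4.basisVector 1) (E4.basisVector 0) = 1 := by
  constructor <;> simp [Fin.sum_univ_three, Fin.succ_ne_zero, E4.basisVector]

/-- **(a), late-time form, empty configuration `N = 0`**: the flat energy inequality
`E[ψ](t) ≤ 18 E[ψ](0)` (`t ≥ 0`) in the crux's lab-energy format. Hawking–Ellis 1973, §4.3,
Lemma 4.3.1 (flat case). [folklore] -/
theorem stub_lateEnergyBound_zero :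
    ∃ d₀ α v₀ : ℝ, 0 < d₀ ∧ 0 < α ∧ 0 < v₀ ∧
    ∀ (M a : Fin 0 → ℝ) (Λ : Fin 0 → lorentzGroup) (p : Fin 0 → E3) (u : Fin 0 → E4)
      (q : Fin 0 → E4 → E4),
      (∀ i, u i = (Λ i : E4 ≃L[ℝ] E4) (E4.basisVector 0)) →
      (∀ i x, q i x = poincareInv (Λ i) (E4.ofTimeSpace 0 (p i)) x) →
      (∀ i, 0 < M i) → (∀ i, |a i| ≤ α * M i) →
      (∀ i, 0 < u i 0 ∧ ‖E4.spatial (u i)‖ ≤ v₀ * u i 0) →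
      (∀ i j, i ≠ j → d₀ * (M i + M j) ≤ dist (p i) (p j) ∧
        0 < ⟪p i - p j, (u i 0)⁻¹ • E4.spatial (u i) - (u j 0)⁻¹ • E4.spatial (u j)⟫_ℝ) →
      ∀ (G : E4 → Fin 4 → Fin 4 → ℝ),
      (∀ x μ ν, G x μ ν = Minkowski.bilin (E4.basisVector μ) (E4.basisVector ν) -
        ∑ i, Real.smoothTransition (2 - Kerr.radius (a i) (q i x) / (8 * M i)) *
          (2 * Kerr.scalarH (M i) (a i) (q i x)) *
          ((Λ i : E4 ≃L[ℝ] E4) (Kerr.nullVector (a i) (q i x))) μ *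
          ((Λ i : E4 ≃L[ℝ] E4) (Kerr.nullVector (a i) (q i x))) ν) →
      ∀ (E : (E4 → ℝ) → ℝ → ENNReal),
      (∀ φ t, E φ t = ∫⁻ y in {y : E3 | ∀ i, Kerr.rPlus (M i) (a i) <
          Kerr.radius (a i) (q i (E4.ofTimeSpace t y))},
        ENNReal.ofReal (∑ μ : Fin 4, (fderiv ℝ φ (E4.ofTimeSpace t y) (E4.basisVector μ)) ^ 2)) →
      ∃ (t₁ : ℝ) (C : NNReal), ∀ ψ : E4 → ℝ, ContDiff ℝ ∞ ψ →
        (∀ x : E4, 0 ≤ x 0 → (∀ i, Kerr.rPlus (M i) (a i) < Kerr.radius (a i) (q i x)) →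
          ∑ μ : Fin 4, fderiv ℝ (fun y ↦ ∑ ν : Fin 4, G y μ ν * fderiv ℝ ψ y (E4.basisVector ν)) x
            (E4.basisVector μ) = 0) →
        ∀ t : ℝ, t₁ ≤ t → E ψ t ≤ (C : ENNReal) * E ψ 0 := by
  refine ⟨40, 2⁻¹, 2⁻¹, by norm_num, by norm_num, by norm_num, ?_⟩
  intro M a Λ p u q hu hq hM ha hv hsep G hG E hE
  refine ⟨0, 18, fun ψ hψ hsol t ht ↦ ?_⟩
  -- `C = 18` as an `ENNReal.ofReal`
  have h18 : ((18 : NNReal) : ENNReal) = ENNReal.ofReal 18 := by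
    rw [ENNReal.ofReal_ofNat]; rfl
  rw [h18]
  -- ### no holes: every `∀ i : Fin 0` clause is vacuous and the patched field is exactly `η`
  have hext : ∀ (x : E4) (i : Fin 0), Kerr.rPlus (M i) (a i) < Kerr.radius (a i) (q i x) :=
    fun x i ↦ i.elim0
  have hGη : ∀ x μ ν, G x μ ν = Kerr.etaComp μ ν := fun x μ ν ↦
    Theorems.cruxField_eq_etaComp_of_far hG hM (fun i ↦ i.elim0) μ ν
  -- (hKS) pointwise normalised Kerr–Schild form with `φ₀ = 0`, `l₀ = −e₀ + e₁`, `Φ = 0`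
  have hKS : ∀ x : E4, ∃ (φ₀ : ℝ) (l₀ : E4), 0 ≤ φ₀ ∧ φ₀ ≤ 0 ∧
      Minkowski.bilin l₀ l₀ = 0 ∧ Minkowski.bilin l₀ (E4.basisVector 0) = 1 ∧
      ∀ μ ν, G x μ ν = Kerr.etaComp μ ν - φ₀ * l₀ μ * l₀ ν := fun x ↦
    ⟨0, -E4.basisVector 0 + E4.basisVector 1, le_rfl, le_rfl, lez_bilin_negBasisZero_add_basisOne.1,
      lez_bilin_negBasisZero_add_basisOne.2, fun μ ν ↦ by rw [hGη]; ring⟩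
  -- (hDb) the components of `G` are constant: `|∂G| ≤ 0`
  have hDb : ∀ (x : E4) (μ α β : Fin 4), |fderiv ℝ (fun y ↦ G y α β) x (E4.basisVector μ)| ≤ 0 := by
    intro x μ α β
    have hc : (fun y ↦ G y α β) = fun _ ↦ Kerr.etaComp α β := funext fun y ↦ hGη y α β
    rw [hc, fderiv_const_apply, zero_apply, abs_zero]
  by_cases htop : E ψ 0 = ⊤
  · rw [htop, ENNReal.mul_top (ENNReal.ofReal_pos.mpr (by norm_num : (0 : ℝ) < 18)).ne']
    exact le_top
  have hhcont : ∀ i : Fin 0, Continuous fun x : E4 ↦ Kerr.horizonFn (M i) (a i) (q i x) :=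
    fun i ↦ i.elim0
  have hrcont : ∀ i : Fin 0, Continuous fun x : E4 ↦ Kerr.radius (a i) (q i x) := fun i ↦ i.elim0
  have hgcont : ∀ s, Continuous fun y : E3 ↦
      ∑ μ : Fin 4, (fderiv ℝ ψ (E4.ofTimeSpace s y) (E4.basisVector μ)) ^ 2 := fun s ↦ by
    refine continuous_finsetSum _ fun μ _ ↦ ?_
    exact (((hψ.continuous_fderiv (by simp)).comp (E4.continuous_ofTimeSpace s)).clm_apply
      continuous_const).pow 2
  have hgnn : ∀ s y, 0 ≤ ∑ μ : Fin 4, (fderiv ℝ ψ (E4.ofTimeSpace s y) (E4.basisVector μ)) ^ 2 :=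
    fun s y ↦ Finset.sum_nonneg fun _ _ ↦ sq_nonneg _
  -- ### the truncated estimate on `{‖y‖ ≤ R}` (the `∀ i` clause is vacuous)
  have key : ∀ (θ R : ℝ), 0 < R →
      ∫⁻ y in {y : E3 | ‖y‖ ≤ R ∧ ∀ i, Kerr.rPlus (M i) (a i) + θ ≤
          Kerr.radius (a i) (q i (E4.ofTimeSpace t y))},
        ENNReal.ofReal (∑ μ : Fin 4, (fderiv ℝ ψ (E4.ofTimeSpace t y) (E4.basisVector μ)) ^ 2) ≤
        ENNReal.ofReal 18 * E ψ 0 := by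
    intro θ R hR
    have hTA : t < t + R + 1 := by linarith
    set ε : Fin 0 → ℝ := fun _ ↦ 1 with hε
    have hεpos : ∀ i, 0 < ε i := fun _ ↦ one_pos
    set W : E4 → ℝ := fun x ↦ Kerr.timeSlabCutoff t (t + R + 1) (x 0) *
        Real.smoothTransition (Kerr.coneFn (t + R + 1) 0 x) *
        ∏ i, Real.smoothTransition (Kerr.horizonFn (M i) (a i) (q i x) / ε i - 1) with hWdef
    obtain ⟨hWC1, hW01, hWsupp, hWone, hWflux⟩ :=
      stub_slabWeight M a Λ p u q hu hq hM ha hv hsep G hG t (t + R + 1) ε hTA hεpos W (fun x ↦ rfl)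
    set K : Set E4 := {x : E4 | -2 ≤ x 0 ∧ x 0 ≤ t + R + 1 ∧ E4.spatialNorm x ≤ t + R + 1 + 2 ∧
      ∀ i, ε i ≤ Kerr.horizonFn (M i) (a i) (q i x)} with hKdef
    have hKclosed : IsClosed K := fte_isClosed_slabSet hhcont ε (t + R + 1) (t + R + 1 + 2)
    have hWK : ∀ x, W x ≠ 0 → x ∈ K := by
      intro x hWx
      obtain ⟨h1, h2, h3, h4⟩ := hWsupp x hWx
      exact ⟨h1.le, h2.le, by linarith, fun i ↦ (h4 i).le⟩
    have hG2K : ∀ x ∈ K, ∀ μ ν, ContDiffAt ℝ 2 (fun y ↦ G y μ ν) x := fun x _ μ ν ↦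
      (Theorems.contDiffAt_cruxField_of_exterior hq hM hG (hext x) μ ν).of_le
        (WithTop.coe_le_coe.mpr le_top)
    have hsolK : ∀ x ∈ K, 0 ≤ x 0 → x 0 ≤ t → KerrSchild.waveOperator G ψ x = 0 := by
      intro x _ hx0 _
      rw [← Theorems.cruxWave_eq_waveOperator]
      exact hsol x hx0 (hext x)
    have hfluxK : ∀ x ∈ K, 0 ≤ x 0 → x 0 ≤ t →
        ∑ μ, fderiv ℝ W x (E4.basisVector μ) * KerrSchild.normalCurrent G ψ x μ ≤ 0 := by
      intro x _ hx0 hxT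
      obtain ⟨φ₀, l₀, hφ0, -, hnull, hnorm, hGx⟩ := hKS x
      exact hWflux ψ x hx0 hxT (hext x) ⟨φ₀, l₀, hφ0, hnull, hnorm, hGx⟩ fun i ↦ i.elim0
    -- the slab Grönwall inequality with `Φ = 0`, `D = 0`: the exponential factor is `1`
    have hgron := stub_slabGronwall G W ψ K 0 0 t (t + R + 1 + 2) le_rfl le_rfl ht hKclosed
      (fun x hx ↦ hx.2.2.1) hWC1 (fun x ↦ (hW01 x).1) hWK hG2K
      (fun x _ μ ν ↦ Theorems.cruxField_symm hG x μ ν) hψ hsolK (fun x _ _ _ ↦ hKS x)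
      (fun x _ _ _ ↦ hDb x) hfluxK t ht le_rfl
    have hexp1 : Real.exp (192 * (1 + 0) * 0 * t) = 1 := by
      rw [mul_zero, zero_mul, Real.exp_zero]
    rw [hexp1, mul_one] at hgron
    have hJcont : Continuous fun x : E4 ↦ W x * KerrSchild.normalCurrent G ψ x 0 := by
      refine continuous_iff_continuousAt.mpr fun x ↦ ?_
      refine continuousAt_weight_mul hKclosed (subset_refl K) hWC1.continuous
        (fun y hy ↦ ?_) (fun y hy ↦ ?_) x
      · by_contra h
        exact hy (hWK y h)
      · exact (fte_contDiffAt_normalCurrent (fun μ ν ↦ (hG2K y hy μ ν).of_le one_le_two)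
          (hψ.contDiffAt.of_le (WithTop.coe_le_coe.mpr le_top)) 0).continuousAt
    have hJnn : ∀ (s : ℝ) (y : E3),
        0 ≤ W (E4.ofTimeSpace s y) * KerrSchild.normalCurrent G ψ (E4.ofTimeSpace s y) 0 := by
      intro s y
      obtain ⟨φ₀, l₀, hφ0, hφΦ, hnull, hnorm, hGx⟩ := hKS (E4.ofTimeSpace s y)
      exact mul_nonneg (hW01 _).1 (fte_pointwise ψ hφ0 hφΦ hnull hnorm hGx).1
    set S : Set E3 := {y : E3 | ‖y‖ ≤ R ∧ ∀ i, Kerr.rPlus (M i) (a i) + θ ≤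
        Kerr.radius (a i) (q i (E4.ofTimeSpace t y))} with hSdef
    have hSball : S ⊆ closedBall (0 : E3) (t + R + 1 + 2) := fun y hy ↦ by
      rw [mem_closedBall, dist_zero_right]; linarith [hy.1]
    have hSclosed : IsClosed S :=
      fte_isClosed_truncSet (fun i ↦ (hrcont i).comp (E4.continuous_ofTimeSpace t)) _ R
    have hWS : ∀ y ∈ S, W (E4.ofTimeSpace t y) = 1 := by
      intro y hy
      apply hWone
      · rw [E4.ofTimeSpace_apply_zero]; exact ht
      · rw [E4.ofTimeSpace_apply_zero]
      · simp only [Kerr.coneFn, E4.ofTimeSpace_apply_zero, E4.spatial_ofTimeSpace, sub_zero]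
        nlinarith [hy.1, norm_nonneg y]
      · exact fun i ↦ i.elim0
    have hcoer : ∀ y ∈ S, (∑ μ : Fin 4, (fderiv ℝ ψ (E4.ofTimeSpace t y) (E4.basisVector μ)) ^ 2) ≤
        6 * (W (E4.ofTimeSpace t y) * KerrSchild.normalCurrent G ψ (E4.ofTimeSpace t y) 0) := by
      intro y hy
      rw [hWS y hy, one_mul]
      obtain ⟨φ₀, l₀, hφ0, hφΦ, hnull, hnorm, hGx⟩ := hKS (E4.ofTimeSpace t y)
      exact (fte_pointwise ψ hφ0 hφΦ hnull hnorm hGx).2.1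
    have hJint : ∀ s, IntegrableOn (fun y : E3 ↦ W (E4.ofTimeSpace s y) *
        KerrSchild.normalCurrent G ψ (E4.ofTimeSpace s y) 0) (closedBall (0 : E3) (t + R + 1 + 2)) :=
      fun s ↦ (hJcont.comp (E4.continuous_ofTimeSpace s)).continuousOn.integrableOn_compact
        (isCompact_closedBall _ _)
    have hgint : IntegrableOn (fun y : E3 ↦
        ∑ μ : Fin 4, (fderiv ℝ ψ (E4.ofTimeSpace t y) (E4.basisVector μ)) ^ 2) S :=
      (((hgcont t).continuousOn).integrableOn_compact (isCompact_closedBall _ _)).mono_set hSball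
    -- the initial weighted energy is at most `3 E[ψ](0)`
    have step0 : (∫ y in closedBall (0 : E3) (t + R + 1 + 2), W (E4.ofTimeSpace 0 y) *
        KerrSchild.normalCurrent G ψ (E4.ofTimeSpace 0 y) 0) ≤ 3 * (E ψ 0).toReal := by
      set g0 : E3 → ℝ := fun y ↦
        ∑ μ : Fin 4, (fderiv ℝ ψ (E4.ofTimeSpace 0 y) (E4.basisVector μ)) ^ 2 with hg0def
      have hpt : ∀ y, W (E4.ofTimeSpace 0 y) * KerrSchild.normalCurrent G ψ (E4.ofTimeSpace 0 y) 0 ≤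
          3 * g0 y := by
        intro y
        obtain ⟨φ₀, l₀, hφ0, hφΦ, hnull, hnorm, hGx⟩ := hKS (E4.ofTimeSpace 0 y)
        have hp := fte_pointwise ψ hφ0 hφΦ hnull hnorm hGx
        calc W (E4.ofTimeSpace 0 y) * KerrSchild.normalCurrent G ψ (E4.ofTimeSpace 0 y) 0
            ≤ 1 * KerrSchild.normalCurrent G ψ (E4.ofTimeSpace 0 y) 0 :=
              mul_le_mul_of_nonneg_right (hW01 _).2 hp.1
          _ = _ := one_mul _
          _ ≤ 3 * (1 + 0) ^ 2 * g0 y := hp.2.2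
          _ = 3 * g0 y := by ring
      have hg0int : IntegrableOn g0 (closedBall (0 : E3) (t + R + 1 + 2)) :=
        (hgcont 0).continuousOn.integrableOn_compact (isCompact_closedBall _ _)
      have hfin : (∫⁻ y in closedBall (0 : E3) (t + R + 1 + 2), ENNReal.ofReal (g0 y)) ≤ E ψ 0 := by
        rw [hE]
        exact lintegral_mono_set fun y _ i ↦ i.elim0
      calc (∫ y in closedBall (0 : E3) (t + R + 1 + 2), W (E4.ofTimeSpace 0 y) *
              KerrSchild.normalCurrent G ψ (E4.ofTimeSpace 0 y) 0)
          ≤ ∫ y in closedBall (0 : E3) (t + R + 1 + 2), 3 * g0 y :=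
            setIntegral_mono (hJint 0) (hg0int.const_mul _) hpt
        _ = 3 * ∫ y in closedBall (0 : E3) (t + R + 1 + 2), g0 y := integral_const_mul _ _
        _ = 3 * (∫⁻ y in closedBall (0 : E3) (t + R + 1 + 2), ENNReal.ofReal (g0 y)).toReal := by
            rw [integral_eq_lintegral_of_nonneg_ae (Eventually.of_forall fun y ↦ hgnn 0 y)
              ((hgcont 0).aestronglyMeasurable)]
        _ ≤ 3 * (E ψ 0).toReal :=
            mul_le_mul_of_nonneg_left (ENNReal.toReal_mono htop hfin) (by norm_num)
    have hreal : ∫ y in S, (∑ μ : Fin 4, (fderiv ℝ ψ (E4.ofTimeSpace t y) (E4.basisVector μ)) ^ 2) ≤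
        18 * (E ψ 0).toReal := by
      have step1 : ∫ y in S, (∑ μ : Fin 4, (fderiv ℝ ψ (E4.ofTimeSpace t y) (E4.basisVector μ)) ^ 2) ≤
          ∫ y in S, 6 * (W (E4.ofTimeSpace t y) *
            KerrSchild.normalCurrent G ψ (E4.ofTimeSpace t y) 0) :=
        setIntegral_mono_on hgint (((hJint t).mono_set hSball).const_mul 6)
          hSclosed.measurableSet hcoer
      have step2 : ∫ y in S, 6 * (W (E4.ofTimeSpace t y) *
            KerrSchild.normalCurrent G ψ (E4.ofTimeSpace t y) 0) =
          6 * ∫ y in S, W (E4.ofTimeSpace t y) *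
            KerrSchild.normalCurrent G ψ (E4.ofTimeSpace t y) 0 := integral_const_mul _ _
      have step3 : (∫ y in S, W (E4.ofTimeSpace t y) *
            KerrSchild.normalCurrent G ψ (E4.ofTimeSpace t y) 0) ≤
          ∫ y in closedBall (0 : E3) (t + R + 1 + 2), W (E4.ofTimeSpace t y) *
            KerrSchild.normalCurrent G ψ (E4.ofTimeSpace t y) 0 :=
        setIntegral_mono_set (hJint t) (Eventually.of_forall (hJnn t))
          (Eventually.of_forall hSball)
      have step4 : (∫ y in closedBall (0 : E3) (t + R + 1 + 2), W (E4.ofTimeSpace t y) *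
            KerrSchild.normalCurrent G ψ (E4.ofTimeSpace t y) 0) ≤ 3 * (E ψ 0).toReal :=
        hgron.trans step0
      calc _ ≤ _ := step1
        _ = _ := step2
        _ ≤ 6 * (3 * (E ψ 0).toReal) := by linarith [step3, step4]
        _ = _ := by ring
    have hlhs : ∫⁻ y in S, ENNReal.ofReal
        (∑ μ : Fin 4, (fderiv ℝ ψ (E4.ofTimeSpace t y) (E4.basisVector μ)) ^ 2) =
        ENNReal.ofReal (∫ y in S,
          ∑ μ : Fin 4, (fderiv ℝ ψ (E4.ofTimeSpace t y) (E4.basisVector μ)) ^ 2) :=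
      (ofReal_integral_eq_lintegral_ofReal hgint (Eventually.of_forall fun y ↦ hgnn t y)).symm
    rw [hlhs]
    calc ENNReal.ofReal (∫ y in S, ∑ μ : Fin 4, (fderiv ℝ ψ (E4.ofTimeSpace t y) (E4.basisVector μ)) ^ 2)
        ≤ ENNReal.ofReal (18 * (E ψ 0).toReal) := ENNReal.ofReal_le_ofReal hreal
      _ = ENNReal.ofReal 18 * ENNReal.ofReal ((E ψ 0).toReal) := ENNReal.ofReal_mul (by norm_num)
      _ = _ := by rw [ENNReal.ofReal_toReal htop]
  -- ### exhaustion of `E3` by the balls `{‖y‖ ≤ n + 1}`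
  obtain ⟨hmono, hUnion⟩ := fte_iUnion_truncSet
    (fun i (y : E3) ↦ Kerr.radius (a i) (q i (E4.ofTimeSpace t y))) (fun i ↦ Kerr.rPlus (M i) (a i))
    one_pos
  have hdir := hmono.directed_le
  rw [hE, hUnion, setLIntegral_iUnion_of_directed _ hdir]
  exact iSup_le fun n ↦ key _ _ (by positivity)


end Summit.FinalStateConjecture.FinalStateConjecture.Cruxes.AdiabaticMultiKerrILED.Sketch

end
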